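import Summits.QuantumFields.YangMills.Theorems.LuscherReductionTwistedTraceScalingBOStiffCoreData
import Summits.QuantumFields.YangMills.Theorems.LuscherReductionTwistedTraceScalingBOStiffCentralData
import HarnessLib

/-!
# (B-ST) (W1-7c) `…BOStiffCoreMass`: integration lemmas and the positivity of the central mass / `cΛ` from the door data
# (lane A of S-BASE, crux `TwistedTraceScaling` stmt-QuantumFields-20203, C4-CORE, the (B-ST) pen; HANDOFF-g21 UPDATE 20:39Z (W1-7))

* §1 `sq_integral_abs_le_mass_mul` (`(∫|f|)² ≤ μ(univ)·∫f²`), `iter_integral_eq_prod`, `iter_integral_mono` (bounded measurable functions on products of finite measures);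
* §2 `cM_pos`, ★ `central_mass_pos` (from `∫_{cS} D > 0`, `D ≤ C'ν cΘ²cW`, the floor and the upper quasimode: `0 < ∫_{cS} cΘ²cW`, `0 < ∫ cΘ²cW`, `0 < cΛ`), `mem_cS`.
HONEST FRAMING: bookkeeping for a stub of a child of the CONDITIONAL route R2b1; (B-ST) OPEN; C4-CORE OPEN; not infinite volume, not a gap, not Clay.
-/

set_option autoImplicit false

noncomputable section

open MeasureTheory Filter Topology Real
open scoped BigOperators
open Literature.MathematicalPhysics.QuantumFieldTheory
open Literature.MathematicalPhysics.QuantumLattice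

namespace Summit.QuantumFields.YangMills.Theorems.FemtoTransferGap.TwoLattice.ConstTube

open Summit.QuantumFields.YangMills.Theorems.FemtoTransferGap
open Summit.QuantumFields.YangMills.Theorems.FemtoTransferGap.TwoLattice
open Summit.QuantumFields.YangMills.Theorems.FemtoTransferGap.TwoLattice.Avg
open Summit.QuantumFields.YangMills.Theorems.FemtoTransferGap.TwoLattice.Stiff (LinkSpace)
open Summit.QuantumFields.YangMills.Theorems.FemtoTransferGap.TwoLattice.GnChart
open Summit.QuantumFields.YangMills.Theorems.TwistedTraceScaling.Negative

variable {L : ℕ} [NeZero L]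

/-! ## §1 Three integration lemmas -/

section Integration

variable {U X : Type*} [MeasurableSpace U] [MeasurableSpace X] {ν : Measure U} {μ : Measure X} [IsFiniteMeasure ν] [IsFiniteMeasure μ]

omit [NeZero L] in
/-- `(∫ |f|)² ≤ μ(univ)·∫ f²` for bounded measurable `f` on a finite measure. [folklore] -/
theorem sq_integral_abs_le_mass_mul {f : X → ℝ} (hf : Measurable f) {C : ℝ} (hC : ∀ x, |f x| ≤ C) :
    (∫ x, |f x| ∂μ) ^ 2 ≤ μ.real Set.univ * ∫ x, f x ^ 2 ∂μ := by
  set m : ℝ := μ.real Set.univ with hmdef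
  set I : ℝ := ∫ x, |f x| ∂μ with hIdef
  have hm0 : 0 ≤ m := measureReal_nonneg
  have hI0 : 0 ≤ I := integral_nonneg fun x => abs_nonneg _
  have hi1 : Integrable (fun x => |f x|) μ := integrable_of_measurable_abs_le μ hf.abs (C := C) fun x => by rw [abs_abs]; exact hC x
  have hi2 : Integrable (fun x => f x ^ 2) μ := integrable_of_measurable_abs_le μ (hf.pow_const 2) (C := C ^ 2) fun x => by
    rw [abs_pow]; exact pow_le_pow_left₀ (abs_nonneg _) (hC x) 2
  have hF0 : 0 ≤ ∫ x, f x ^ 2 ∂μ := integral_nonneg fun x => sq_nonneg _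
  by_cases hm : m = 0
  · -- `μ = 0`-mass: `∫|f| = 0`
    have hμ : μ.real Set.univ = 0 := hm
    have hI : I = 0 := by
      have h := norm_integral_le_of_norm_le_const (μ := μ) (f := fun x => |f x|) (C := C) (Filter.Eventually.of_forall fun x => by
        rw [Real.norm_eq_abs, abs_abs]; exact hC x)
      rw [hμ, mul_zero, Real.norm_eq_abs] at h
      exact le_antisymm ((le_abs_self _).trans h) hI0
    rw [hI, hm]; simp
  · have hmpos : 0 < m := lt_of_le_of_ne hm0 (Ne.symm hm)
    -- `0 ≤ ∫ (|f| − I/m)² = ∫f² − 2(I/m)I + (I/m)²m`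
    have hexp : ∫ x, (|f x| - I / m) ^ 2 ∂μ = (∫ x, f x ^ 2 ∂μ) - 2 * (I / m) * I + (I / m) ^ 2 * m := by
      have e : (fun x => (|f x| - I / m) ^ 2) = fun x => f x ^ 2 - 2 * (I / m) * |f x| + (I / m) ^ 2 := by
        funext x; rw [sub_sq, sq_abs]; ring
      have hi3 : Integrable (fun x => 2 * (I / m) * |f x|) μ := hi1.const_mul _
      have hi4 : Integrable (fun x => f x ^ 2 - 2 * (I / m) * |f x|) μ := hi2.sub hi3
      rw [e, integral_add hi4 (integrable_const _), integral_sub hi2 hi3, integral_const_mul, integral_const, smul_eq_mul]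
      ring
    have hnn : 0 ≤ ∫ x, (|f x| - I / m) ^ 2 ∂μ := integral_nonneg fun x => sq_nonneg _
    rw [hexp] at hnn
    have e2 : (∫ x, f x ^ 2 ∂μ) - 2 * (I / m) * I + (I / m) ^ 2 * m = (∫ x, f x ^ 2 ∂μ) - I ^ 2 / m := by field_simp; ring
    rw [e2, sub_nonneg, div_le_iff₀ hmpos] at hnn
    linarith

omit [NeZero L] in
/-- Iterated integrals of bounded measurable functions on a product of finite measures are product integrals. [folklore] -/
theorem iter_integral_eq_prod {F : U × X → ℝ} (hF : Measurable F) {C : ℝ} (hC : ∀ p, |F p| ≤ C) :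
    ∫ u, ∫ x, F (u, x) ∂μ ∂ν = ∫ p, F p ∂ν.prod μ :=
  (integral_prod F (integrable_of_measurable_abs_le (ν.prod μ) hF hC)).symm

omit [NeZero L] in
/-- Monotonicity of iterated integrals for bounded measurable `F ≤ G`. [folklore] -/
theorem iter_integral_mono {F G : U × X → ℝ} (hF : Measurable F) {CF : ℝ} (hCF : ∀ p, |F p| ≤ CF) (hG : Measurable G) {CG : ℝ} (hCG : ∀ p, |G p| ≤ CG)
    (hFG : ∀ p, F p ≤ G p) : ∫ u, ∫ x, F (u, x) ∂μ ∂ν ≤ ∫ u, ∫ x, G (u, x) ∂μ ∂ν := by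
  rw [iter_integral_eq_prod hF hCF, iter_integral_eq_prod hG hCG]
  exact integral_mono (integrable_of_measurable_abs_le _ hF hCF) (integrable_of_measurable_abs_le _ hG hCG) hFG

end Integration

/-! ## §2 Positivity of the central kernel, mass and `cΛ` from the door data -/

/-- `cM β x y > 0`. [folklore] -/
theorem cM_pos (β : ℝ) (x y : Edge 3 L → Fin 3 → ℝ) : 0 < cM L β x y := by
  haveI : IsProbabilityMeasure (basedMeasure L) := by unfold basedMeasure; infer_instance
  obtain ⟨M, hM⟩ := exists_transferKernel_le su2Rep continuous_su2Rep β (L := L)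
  unfold cM
  have hKm : Measurable fun h : NzSite L → SU2 => transferKernel su2Rep β (orthoTube L 1 x) (gaugeTransform (basedExt L h) (orthoTube L 1 y)) :=
    (measurable_transferKernel_gaugeTransform_right β _ _).comp (measurable_basedExt L)
  have hint : Integrable (fun h : NzSite L → SU2 => transferKernel su2Rep β (orthoTube L 1 x) (gaugeTransform (basedExt L h) (orthoTube L 1 y))) (basedMeasure L) :=
    integrable_of_measurable_abs_le _ hKm (C := M) fun h => by rw [abs_of_pos (transferKernel_pos _ _ _ _)]; exact hM _ _
  rw [integral_pos_iff_support_of_nonneg (fun h => (transferKernel_pos su2Rep β _ _).le) hint]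
  have hsupp : Function.support (fun h : NzSite L → SU2 => transferKernel su2Rep β (orthoTube L 1 x) (gaugeTransform (basedExt L h) (orthoTube L 1 y))) = Set.univ :=
    Set.eq_univ_of_forall fun h => (transferKernel_pos su2Rep β _ _).ne'
  rw [hsupp, measure_univ]; exact one_pos

/-- From the door data at `β` (`∫_{cS} D > 0`, `D ≤ C'ν·cΘ²cW` on `cS`, a floor `θ₀ ≤ cΘ` on `cS`) and the upper quasimode on `cS`:
`0 < ∫_{cS} cΘ²cW`, `0 < ∫ cΘ²cW`, `0 < cΛ`. [folklore] -/
theorem central_mass_pos {s M β : ℝ} (hβ : 0 ≤ β) {D : (Edge 3 L → Fin 3 → ℝ) → ℝ} {CD C'ν θ₀ η : ℝ} (hD : Measurable D) (hDb : ∀ x, |D x| ≤ CD) (hC'ν : 0 < C'ν)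
    (hθ₀ : 0 < θ₀) (hΘlo : ∀ x ∈ cS L β, θ₀ ≤ cΘ L β x) (hZD : 0 < ∫ x in cS L β, D x ∂orthoTransverse L)
    (hν' : ∀ x ∈ cS L β, D x ≤ C'ν * (cΘ L β x ^ 2 * cW L s M β x)) (hη : 0 ≤ η)
    (hup : ∀ x ∈ cS L β, ∫ y, cM L β x y * cΘ L β y ∂orthoTransverse L ≤ (1 + η) * cΛ L s M β * (cΘ L β x * cW L s M β x)) :
    0 < ∫ x in cS L β, cΘ L β x ^ 2 * cW L s M β x ∂orthoTransverse L ∧ 0 < ∫ x, cΘ L β x ^ 2 * cW L s M β x ∂orthoTransverse L ∧ 0 < cΛ L s M β := by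
  haveI := isFiniteMeasure_orthoTransverse L
  obtain ⟨hMm, ⟨CM, hMb⟩, -, -, hΘm, hΘ1, hΘ0, hΘS, hSm⟩ := central_kform_data (L := L) hβ
  obtain ⟨hwm, hwb, hw0⟩ := cW_props (L := L) s M β
  have hΘle1 : ∀ x, cΘ L β x ≤ 1 := fun x => (le_abs_self _).trans (hΘ1 x)
  have hfm : Measurable fun x => cΘ L β x ^ 2 * cW L s M β x := (hΘm.pow_const 2).mul hwm
  have hfi : Integrable (fun x => cΘ L β x ^ 2 * cW L s M β x) (orthoTransverse L) :=
    integrable_of_measurable_abs_le _ hfm (C := 1 * Real.exp ((Fintype.card (Edge 3 L) : ℝ) / powScale 1 β ^ 2)) fun x => by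
      rw [abs_mul, abs_pow]
      exact mul_le_mul (by rw [← one_pow 2]; exact pow_le_pow_left₀ (abs_nonneg _) (hΘ1 x) 2) (hwb x) (abs_nonneg _) zero_le_one
  have hf0 : ∀ x, 0 ≤ cΘ L β x ^ 2 * cW L s M β x := fun x => mul_nonneg (sq_nonneg _) (hw0 x)
  have hDi : Integrable D (orthoTransverse L) := integrable_of_measurable_abs_le _ hD hDb
  -- `∫_S D ≤ C'ν ∫_S Θ²w`
  have h1 : ∫ x in cS L β, D x ∂orthoTransverse L ≤ C'ν * ∫ x in cS L β, cΘ L β x ^ 2 * cW L s M β x ∂orthoTransverse L := by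
    rw [← integral_const_mul]
    exact setIntegral_mono_on hDi.integrableOn (hfi.const_mul _).integrableOn hSm fun x hx => hν' x hx
  have hZS : 0 < ∫ x in cS L β, cΘ L β x ^ 2 * cW L s M β x ∂orthoTransverse L := by
    by_contra hle
    push Not at hle
    have : C'ν * ∫ x in cS L β, cΘ L β x ^ 2 * cW L s M β x ∂orthoTransverse L ≤ 0 := mul_nonpos_of_nonneg_of_nonpos hC'ν.le hle
    linarith
  have hZ : 0 < ∫ x, cΘ L β x ^ 2 * cW L s M β x ∂orthoTransverse L :=
    lt_of_lt_of_le hZS (setIntegral_le_integral hfi (ae_of_all _ hf0))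
  refine ⟨hZS, hZ, ?_⟩
  -- a point of `cS` (it has positive measure)
  have hSpos : 0 < orthoTransverse L (cS L β) := by
    by_contra hle
    push Not at hle
    have h0 : orthoTransverse L (cS L β) = 0 := nonpos_iff_eq_zero.mp hle
    have : ∫ x in cS L β, cΘ L β x ^ 2 * cW L s M β x ∂orthoTransverse L = 0 := by rw [Measure.restrict_eq_zero.mpr h0, integral_zero_measure]
    linarith
  obtain ⟨x₀, hx₀⟩ := nonempty_of_measure_ne_zero hSpos.ne'
  -- `0 < ∫ cM(x₀,·) cΘ`
  have hgm : Measurable fun y => cM L β x₀ y * cΘ L β y := (hMm.comp (measurable_const.prodMk measurable_id)).mul hΘm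
  have hgi : Integrable (fun y => cM L β x₀ y * cΘ L β y) (orthoTransverse L) :=
    integrable_of_measurable_abs_le _ hgm (C := CM * 1) fun y => by rw [abs_mul]; exact mul_le_mul (hMb _ _) (hΘ1 y) (abs_nonneg _) ((abs_nonneg _).trans (hMb x₀ y))
  have hg0 : ∀ y, 0 ≤ cM L β x₀ y * cΘ L β y := fun y => mul_nonneg (cM_pos β x₀ y).le (hΘ0 y)
  have hIpos : 0 < ∫ y, cM L β x₀ y * cΘ L β y ∂orthoTransverse L := by
    rw [integral_pos_iff_support_of_nonneg hg0 hgi]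
    refine lt_of_lt_of_le hSpos (measure_mono fun y hy => ?_)
    exact (mul_pos (cM_pos β x₀ y) (lt_of_lt_of_le hθ₀ (hΘlo y hy))).ne'
  have hu := hup x₀ hx₀
  by_contra hΛ
  push Not at hΛ
  have : (1 + η) * cΛ L s M β * (cΘ L β x₀ * cW L s M β x₀) ≤ 0 :=
    mul_nonpos_of_nonpos_of_nonneg (mul_nonpos_of_nonneg_of_nonpos (by linarith) hΛ) (mul_nonneg (hΘ0 x₀) (hw0 x₀))
  linarith


/-- Points of `cS β` lie in the cap with `‖x̂‖ ≤ r_f(β)`. [folklore] -/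
theorem mem_cS {β : ℝ} {x : Edge 3 L → Fin 3 → ℝ} (hx : x ∈ cS L β) : x ∈ capBalancedSet L ∧ ‖linkEmbed L x‖ ≤ min (1 / 40) (powScale (1 / 2) β * btLog β) := by
  have hne : cΘ L β x ≠ 0 := hx
  unfold cΘ cΩ at hne
  have h1 : linkEmbed L x ∈ {y : LinkSpace L | linkCurry y ∈ capBalancedSet L} := by
    by_contra h; exact hne (by rw [Set.indicator_of_notMem h, zero_mul])
  have hcap : x ∈ capBalancedSet L := by
    have e : linkCurry (linkEmbed L x) = x := by funext e a; rfl
    have h2 : linkCurry (linkEmbed L x) ∈ capBalancedSet L := h1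
    rwa [e] at h2
  exact ⟨hcap, norm_le_of_frozenProfile_ne_zero _ _ β (right_ne_zero_of_mul hne)⟩


end Summit.QuantumFields.YangMills.Theorems.FemtoTransferGap.TwoLattice.ConstTube

end
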